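import Summits.QuantumFields.YangMills.Theorems.UnitScaleTiltProp7CornerCombFlatStructure
import Summits.QuantumFields.YangMills.Theorems.UnitScaleTiltProp7CornerCombFlatJensen
import Summits.QuantumFields.YangMills.Theorems.UnitScaleTiltProp7CornerCombFlatPieces
import HarnessLib

/-!
# (n3)-COMB (II) «COMB = STRAIGHT ∘ BLOCK-AXIAL», row `hMcomb₂`, located difficulty H2-1 — THE FLAT `ℓ¹` KNIT:
# `ℓ¹` OF THE `k`-FOLD CORNERED COMB AVERAGE WITH CORNER-LOCALISED READING OF THE SOURCE (flat, abelian; any `d`, any `L ≥ 1`)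

Crux `stmt-QuantumFields-19200` `MinimiserStabilityRegPr`, route-R E′ (A′)-on-Σ, package P-A2, row (β); supplier design (II) (★routeR-w1 g9 MASTER
`DESIGN-N3COMB-LINEAR-CORE` 6efb31c3 §4: `hMcomb₂`, LOCATED DIFFICULTY H2-1 «the `Λ`-sector of the propagator is `O(1)` in `ℓ¹` but only SAMPLES the source near the
coarse corners»; px18 g4 LOCATE `LOCATE-H2-1-KNIT-px18g4.md` ba06020f §1–§2; px13 g6 «GO» 07:47:21Z; px21 g7 LOCATE 3c6e40d5 (4): localise at the source level only).
Width seat `ym3-torus-px18` (gen 4); `--kind proof --supports stmt-QuantumFields-19200 --as helper`; THEOREMS ONLY (0 `def`, 0 `sorry`); «(O2) groundwork — not consumed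
by any displayed row before the freeze lifts»; count-neutral.  YM₃ on T³ is a ladder rung (R3), not Clay; nothing here is progress on the YM mass gap.

## The point
✓II-1 `cornerComb_flat_structure` writes the `k`-fold linearised cornered comb average of a bond field `X = B 0` as the STRAIGHT tower plus the coarse gradient of the corner
potential: `B k z κ = S k z κ + Σ_{m<k}(D m (L^{k−m}•z) − D m (L^{k−m}•(z + e κ)))`.  In `ℓ¹` the straight tower CONTRACTS by `L·L⁻ᵈ` per step (column count — the `ℓ¹`
twin of ✓II-2's Jensen), while the corner pieces do not; but `D m` at the level-`k` corner `L^{k−m}•z` READS the level-`m` straight field only on the corner box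
`L^{k−m}•z + [0,L)ᵈ` (✓II-2b `mem_steps_treeWord_inBox`), and that in turn reads `X` only on a cornered box of side `< 2L^{m+1}` below the corner (localised column
count).  This file proves exactly these three rows with ABSORBING-SET hypotheses (the consumer instantiates the boxes ∕ period cells).  The analytic input that cashes the localisation — the `d = 3` localised-mass (Hardy-type) row — is ✓p705643 ∕ ✓p706697 (not imported here).

## What is here (ns `…Theorems.Prop7CornerCombFlatL1Localised`; letters lit `B7Prop1Explicit`: `Site`, `asum`, `seg`, `treeWord`, `boxVec`, `e`; ✓II-1's binders `hB hS0 hS hD`)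
* §1 `ℓ¹` OF THE STRAIGHT STEP ∕ TOWER WITH ABSORBING SETS: `straight_step_norm_le` (pointwise), ★ `straight_step_sum_norm_le_fold` (period-cell form, multiplicity hypothesis),
  ★ `straight_step_sum_norm_le` (`Σ_{z∈Zc}‖S(m+1) z κ‖ ≤ L·L⁻ᵈ·Σ_{y∈Zf}‖S m y κ‖` whenever `Zf ⊇ L•Zc + [0,L)ᵈ + [0,L)e_κ`), ★★ `straight_tower_sum_norm_le`
  (`Σ_{z∈Z k}‖S k z κ‖ ≤ (L·L⁻ᵈ)ᵏ·Σ_{y∈Z 0}‖S 0 y κ‖` along an absorbing chain `Z` — localisation = the choice of `Z`), `weight_l1_pow_d3` (`(L·L⁻³)ᵏ = (L²)⁻ᵏ`).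
* §2 CORNER-PIECE `ℓ¹` LOCALITY: ★ `norm_cornerPiece_le_box` (`‖D m y‖ ≤ d·L·Σ_{x∈Bx}Σ_μ‖S m x μ‖` for ANY finite `Bx` containing the step sites of the tree words from `y`; crude
  L-only weight `d·L` instead of the trunk's `1`), `steps_mem_cornerBox` (the corner box `{y + boxVec L r}` qualifies), ★★ `norm_cornerPiece_le_localised` (§2 ∘ §1 along a
  localised absorbing chain `U` down to level 0: `‖D m y‖ ≤ d·L·(L·L⁻ᵈ)ᵐ·Σ_{x∈U 0}Σ_μ‖S 0 x μ‖`).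
* §3 THE `ℓ¹` KNIT: ★★ `sum_norm_cornerComb_le` (`Σ_{z∈Zk}Σ_κ‖B k z κ‖ ≤ Σ‖S k‖ + Σ_{m<k}Σ_{z,κ}(‖D m (L^{k−m}•z)‖ + ‖D m (L^{k−m}•(z+e κ))‖)`),
  ★★★ `sum_norm_cornerComb_le_localised` — THE ROW: straight part `(L·L⁻ᵈ)ᵏ·Σ_{Z 0}‖X‖` + Λ-part `d·L·Σ_{m<k}(L·L⁻ᵈ)ᵐ·Σ_{z∈Zk,κ}(Σ_{U_m(L^{k−m}z) 0}‖X‖ + Σ_{U_m(L^{k−m}(z+eκ)) 0}‖X‖)`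
  with every reading set an absorbing-chain HYPOTHESIS.
* (companion file `…CornerCombH21DoubleSums`: the `d = 3` double geometric sums of the H2-1 knit, `l` entering only through `Lˡ`.)
DEPENDENCE: every constant is a closed monomial in `(d, L)`; NOTHING reads `k` beyond the displayed powers, nor the torus, `K`, `n`, the member.  NOT HERE: the tied-source step
`|rem| ≤ 260m² ≤ C·`two-block `ℓ²` (✓p702302∕✓p706210), the localised-mass row (✓p705643∕✓p706697), transports∕dressing (F-5∕F-6), the member (H-3).
HONEST: flat finite-sum bookkeeping; nothing of H2-1's member ∕ `hMcomb₂` ∕ `hMcomb` ∕ (β) ∕ `hD` ∕ the crux is proved or claimed; rung R3 (YM₃ on T³), NOT d = 4, NOT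
infinite volume, NOT Clay; YM gap NOT proved.
References: T. Bałaban, CMP 98 (1985) 17–51 [Balaban1985Averaging] ((42)–(43) pp.23–24, (125) p.36); CMP 109 (1987) 249–301 [Balaban1987RG1] ((0.1) p.251).
-/

set_option autoImplicit false

open scoped BigOperators
open Finset
open Literature.MathematicalPhysics.QuantumFieldTheory.Balaban1983to89.B7Prop1Explicit
open Summit.QuantumFields.YangMills.Theorems.Prop7CornerCombFlatStructure (cornerComb_flat_structure)
open Summit.QuantumFields.YangMills.Theorems.Prop7CornerCombFlatJensen (straight_step_eq_sum card_fiber_le)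
open Summit.QuantumFields.YangMills.Theorems.Prop7CornerCombFlatPieces (cornerPiece_eq_sum_steps mem_steps_treeWord_inBox sum_weight_length_treeWord_le)

namespace Summit.QuantumFields.YangMills.Theorems.Prop7CornerCombFlatL1Localised

variable {d : ℕ} {𝔸 : Type*} [NormedRing 𝔸] [NormedSpace ℝ 𝔸]

/-! ## §1 `ℓ¹` of the straight step and tower with absorbing sets -/

/-- POINTWISE: `‖S(m+1) z κ‖ ≤ L⁻ᵈ·Σ_{r,t<L}‖S m (L•z + r + t•e_κ) κ‖` (triangle inequality on ✓`straight_step_eq_sum`). [cite: Balaban1985Averaging, (125) p.36] -/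
theorem straight_step_norm_le (L : ℕ) (Sm Sm1 : Site d → Fin d → 𝔸) (z : Site d) (κ : Fin d)
    (h : Sm1 z κ = ∑ r : Fin d → Fin L, (((L : ℝ) ^ d)⁻¹) • asum Sm ((L : ℤ) • z + boxVec L r) (seg κ (L : ℤ))) :
    ‖Sm1 z κ‖ ≤ ((L : ℝ) ^ d)⁻¹ * ∑ r : Fin d → Fin L, ∑ t ∈ Finset.range L, ‖Sm ((L : ℤ) • z + boxVec L r + (t : ℤ) • e κ) κ‖ := by
  have hc0 : 0 ≤ ((L : ℝ) ^ d)⁻¹ := by positivity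
  rw [straight_step_eq_sum L Sm Sm1 z κ h, Finset.mul_sum]
  refine (norm_sum_le _ _).trans (Finset.sum_le_sum fun r _ => ?_)
  rw [Finset.mul_sum]
  refine (norm_sum_le _ _).trans (Finset.sum_le_sum fun t _ => ?_)
  exact (norm_smul_le _ _).trans (by rw [Real.norm_of_nonneg hc0])

/-- ★ **SUMMED `ℓ¹` STEP THROUGH A FOLD** (period-cell form): with `fold : Site d → ι` (e.g. reduction modulo the period), `T i ≥ ‖S m y κ‖` on the class of `y`, and every class
`i ∈ Zf` hit by at most `L` triples `(z,r,t) ∈ Zc × [0,L)ᵈ × [0,L)` through `fold (L•z + r + t•e_κ)`: `Σ_{z∈Zc}‖S(m+1) z κ‖ ≤ L·L⁻ᵈ·Σ_{i∈Zf} T i` — the `ℓ¹` contraction `L^{1−d}`.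
[folklore] [cite: Balaban1985Averaging, (125) p.36] -/
theorem straight_step_sum_norm_le_fold (L : ℕ) (Sm Sm1 : Site d → Fin d → 𝔸) (κ : Fin d)
    (h : ∀ z : Site d, Sm1 z κ = ∑ r : Fin d → Fin L, (((L : ℝ) ^ d)⁻¹) • asum Sm ((L : ℤ) • z + boxVec L r) (seg κ (L : ℤ)))
    (Zc : Finset (Site d)) {ι : Type*} [DecidableEq ι] (fold : Site d → ι) (Zf : Finset ι) (T : ι → ℝ)
    (hT : ∀ z ∈ Zc, ∀ (r : Fin d → Fin L) (t : ℕ), t < L →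
      ‖Sm ((L : ℤ) • z + boxVec L r + (t : ℤ) • e κ) κ‖ ≤ T (fold ((L : ℤ) • z + boxVec L r + (t : ℤ) • e κ)))
    (hmaps : ∀ z ∈ Zc, ∀ (r : Fin d → Fin L) (t : ℕ), t < L → fold ((L : ℤ) • z + boxVec L r + (t : ℤ) • e κ) ∈ Zf)
    (hT0 : ∀ i ∈ Zf, 0 ≤ T i)
    (hmult : ∀ i ∈ Zf, #{p ∈ Zc ×ˢ ((Finset.univ : Finset (Fin d → Fin L)) ×ˢ Finset.range L) |
        fold ((L : ℤ) • p.1 + boxVec L p.2.1 + (p.2.2 : ℤ) • e κ) = i} ≤ L) :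
    ∑ z ∈ Zc, ‖Sm1 z κ‖ ≤ (L : ℝ) * ((L : ℝ) ^ d)⁻¹ * ∑ i ∈ Zf, T i := by
  classical
  set P : Finset (Site d × ((Fin d → Fin L) × ℕ)) := Zc ×ˢ ((Finset.univ : Finset (Fin d → Fin L)) ×ˢ Finset.range L) with hP
  set π : Site d × ((Fin d → Fin L) × ℕ) → Site d := fun p => (L : ℤ) • p.1 + boxVec L p.2.1 + (p.2.2 : ℤ) • e κ with hπ
  have hc0 : 0 ≤ ((L : ℝ) ^ d)⁻¹ := by positivity
  -- pointwise bound summed over `Zc`, written over the product index set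
  have h1 : ∑ z ∈ Zc, ‖Sm1 z κ‖ ≤ ((L : ℝ) ^ d)⁻¹ * ∑ p ∈ P, T (fold (π p)) := by
    calc ∑ z ∈ Zc, ‖Sm1 z κ‖
        ≤ ∑ z ∈ Zc, ((L : ℝ) ^ d)⁻¹ * ∑ r : Fin d → Fin L, ∑ t ∈ Finset.range L, ‖Sm ((L : ℤ) • z + boxVec L r + (t : ℤ) • e κ) κ‖ :=
          Finset.sum_le_sum fun z _ => straight_step_norm_le L Sm Sm1 z κ (h z)
      _ ≤ ∑ z ∈ Zc, ((L : ℝ) ^ d)⁻¹ * ∑ r : Fin d → Fin L, ∑ t ∈ Finset.range L, T (fold ((L : ℤ) • z + boxVec L r + (t : ℤ) • e κ)) := by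
          refine Finset.sum_le_sum fun z hz => mul_le_mul_of_nonneg_left ?_ hc0
          exact Finset.sum_le_sum fun r _ => Finset.sum_le_sum fun t ht => hT z hz r t (Finset.mem_range.mp ht)
      _ = ((L : ℝ) ^ d)⁻¹ * ∑ p ∈ P, T (fold (π p)) := by
          rw [← Finset.mul_sum, hP, Finset.sum_product]
          simp only [Finset.sum_product, hπ]
  -- regroup by the fold class and use the multiplicity bound
  have h2 : ∑ p ∈ P, T (fold (π p)) ≤ (L : ℝ) * ∑ i ∈ Zf, T i := by
    rw [Finset.sum_comp (s := P) (f := T) (g := fun p => fold (π p))]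
    have hsub : P.image (fun p => fold (π p)) ⊆ Zf := by
      intro i hi
      obtain ⟨p, hp, rfl⟩ := Finset.mem_image.mp hi
      rw [hP, Finset.mem_product, Finset.mem_product] at hp
      exact hmaps p.1 hp.1 p.2.1 p.2.2 (Finset.mem_range.mp hp.2.2)
    calc ∑ i ∈ P.image (fun p => fold (π p)), (#{p ∈ P | fold (π p) = i}) • T i
        ≤ ∑ i ∈ P.image (fun p => fold (π p)), (L : ℝ) * T i := by
          refine Finset.sum_le_sum fun i hi => ?_
          rw [nsmul_eq_mul]
          exact mul_le_mul_of_nonneg_right (by exact_mod_cast hmult i (hsub hi)) (hT0 i (hsub hi))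
      _ ≤ ∑ i ∈ Zf, (L : ℝ) * T i :=
          Finset.sum_le_sum_of_subset_of_nonneg hsub fun i hi _ => mul_nonneg (Nat.cast_nonneg _) (hT0 i hi)
      _ = (L : ℝ) * ∑ i ∈ Zf, T i := by rw [Finset.mul_sum]
  calc ∑ z ∈ Zc, ‖Sm1 z κ‖ ≤ ((L : ℝ) ^ d)⁻¹ * ∑ p ∈ P, T (fold (π p)) := h1
    _ ≤ ((L : ℝ) ^ d)⁻¹ * ((L : ℝ) * ∑ i ∈ Zf, T i) := mul_le_mul_of_nonneg_left h2 hc0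
    _ = (L : ℝ) * ((L : ℝ) ^ d)⁻¹ * ∑ i ∈ Zf, T i := by ring

/-- ★ **SUMMED `ℓ¹` STEP ON `ℤᵈ`** (fold = identity; multiplicity `≤ L` by ✓`card_fiber_le`): for every finite set `Zc` of coarse sites and every finite `Zf` containing all
`L•z + r + t•e_κ` (`z ∈ Zc`, `r ∈ [0,L)ᵈ`, `t < L`): `Σ_{z∈Zc}‖S(m+1) z κ‖ ≤ L·L⁻ᵈ·Σ_{y∈Zf}‖S m y κ‖` — LOCALISATION IS THE CHOICE OF `Zc ⊆ Zf`-PAIRS.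
[folklore] [cite: Balaban1985Averaging, (125) p.36] -/
theorem straight_step_sum_norm_le (L : ℕ) (hL : 1 ≤ L) (Sm Sm1 : Site d → Fin d → 𝔸) (κ : Fin d)
    (h : ∀ z : Site d, Sm1 z κ = ∑ r : Fin d → Fin L, (((L : ℝ) ^ d)⁻¹) • asum Sm ((L : ℤ) • z + boxVec L r) (seg κ (L : ℤ)))
    (Zc Zf : Finset (Site d))
    (hZf : ∀ z ∈ Zc, ∀ (r : Fin d → Fin L) (t : ℕ), t < L → (L : ℤ) • z + boxVec L r + (t : ℤ) • e κ ∈ Zf) :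
    ∑ z ∈ Zc, ‖Sm1 z κ‖ ≤ (L : ℝ) * ((L : ℝ) ^ d)⁻¹ * ∑ y ∈ Zf, ‖Sm y κ‖ := by
  classical
  refine straight_step_sum_norm_le_fold L Sm Sm1 κ h Zc id Zf (fun y => ‖Sm y κ‖) (fun z _ r t _ => le_rfl) hZf
    (fun i _ => norm_nonneg _) fun y _ => ?_
  refine card_fiber_le L hL κ _ (fun p hp => ?_) y
  rw [Finset.mem_product, Finset.mem_product] at hp
  exact Finset.mem_range.mp hp.2.2

/-- ★★ **`ℓ¹` OF THE STRAIGHT TOWER ALONG AN ABSORBING CHAIN**: if `S (m+1)` is the straight step of `S m` (direction `κ`) and `L•z + r + t•e_κ ∈ Z m` whenever `z ∈ Z (m+1)`,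
`m < k`, then `Σ_{z∈Z k}‖S k z κ‖ ≤ (L·L⁻ᵈ)ᵏ·Σ_{y∈Z 0}‖S 0 y κ‖` (`d = 3`: `(L²)⁻ᵏ`, ★`weight_l1_pow_d3`).  With `Z m :=` period cells this is the global `ℓ¹` contraction of
MASTER §4; with `Z m :=` the cornered boxes below a coarse corner it is the LOCALISED column count. [folklore] [cite: Balaban1985Averaging, (125) p.36, (43) p.24] -/
theorem straight_tower_sum_norm_le (L : ℕ) (hL : 1 ≤ L) (S : ℕ → Site d → Fin d → 𝔸) (κ : Fin d)
    (hS : ∀ (m : ℕ) (z : Site d),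
      S (m + 1) z κ = ∑ r : Fin d → Fin L, (((L : ℝ) ^ d)⁻¹) • asum (S m) ((L : ℤ) • z + boxVec L r) (seg κ (L : ℤ)))
    (k : ℕ) (Z : ℕ → Finset (Site d))
    (hZ : ∀ m, m < k → ∀ z ∈ Z (m + 1), ∀ (r : Fin d → Fin L) (t : ℕ), t < L → (L : ℤ) • z + boxVec L r + (t : ℤ) • e κ ∈ Z m) :
    ∑ z ∈ Z k, ‖S k z κ‖ ≤ ((L : ℝ) * ((L : ℝ) ^ d)⁻¹) ^ k * ∑ y ∈ Z 0, ‖S 0 y κ‖ := by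
  induction k with
  | zero => simp
  | succ k ih =>
    have hstep := straight_step_sum_norm_le L hL (S k) (S (k + 1)) κ (hS k) (Z (k + 1)) (Z k) (hZ k (Nat.lt_succ_self k))
    have ih' := ih fun m hm => hZ m (Nat.lt_succ_of_lt hm)
    have hc0 : 0 ≤ (L : ℝ) * ((L : ℝ) ^ d)⁻¹ := by positivity
    calc ∑ z ∈ Z (k + 1), ‖S (k + 1) z κ‖ ≤ (L : ℝ) * ((L : ℝ) ^ d)⁻¹ * ∑ y ∈ Z k, ‖S k y κ‖ := hstep
      _ ≤ (L : ℝ) * ((L : ℝ) ^ d)⁻¹ * (((L : ℝ) * ((L : ℝ) ^ d)⁻¹) ^ k * ∑ y ∈ Z 0, ‖S 0 y κ‖) := mul_le_mul_of_nonneg_left ih' hc0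
      _ = ((L : ℝ) * ((L : ℝ) ^ d)⁻¹) ^ (k + 1) * ∑ y ∈ Z 0, ‖S 0 y κ‖ := by ring

/-- In three dimensions the `k`-fold `ℓ¹` weight is `(L²)⁻ᵏ`: `(L·L⁻³)ᵏ = ((L²)ᵏ)⁻¹`. [folklore] -/
theorem weight_l1_pow_d3 (L : ℕ) (hL : 1 ≤ L) (k : ℕ) :
    ((L : ℝ) * ((L : ℝ) ^ 3)⁻¹) ^ k = (((L : ℝ) ^ 2) ^ k)⁻¹ := by
  have hL0 : (L : ℝ) ≠ 0 := by exact_mod_cast (show L ≠ 0 by omega)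
  have h : (L : ℝ) * ((L : ℝ) ^ 3)⁻¹ = ((L : ℝ) ^ 2)⁻¹ := by
    field_simp
  rw [h, inv_pow]

/-! ## §2 Corner-piece `ℓ¹` locality -/

omit [NormedSpace ℝ 𝔸] in
/-- triangle inequality along a list: `‖Σ_{s∈l} f s‖ ≤ Σ_{s∈l} ‖f s‖`. [folklore] -/
theorem norm_list_map_sum_le {σ : Type*} (f : σ → 𝔸) : ∀ l : List σ, ‖(l.map f).sum‖ ≤ (l.map fun s => ‖f s‖).sum
  | [] => by simp
  | a :: l => by
    rw [List.map_cons, List.map_cons, List.sum_cons, List.sum_cons]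
    exact (norm_add_le _ _).trans (add_le_add le_rfl (norm_list_map_sum_le f l))

/-- ★ **CORNER-PIECE `ℓ¹` LOCALITY**: with `D m y = Σ_r L⁻ᵈ • asum (S m) y (treeWord (boxVec L r))` (✓II-1's `hD`) and ANY finite set `Bx` of sites containing every step site of
the tree words from `y` (✓II-2b `mem_steps_treeWord_inBox`: the corner box `y + [0,L)ᵈ` qualifies), `‖D m y‖ ≤ d·L·Σ_{x∈Bx}Σ_μ‖S m x μ‖` — each step term is one summand of the box
sum, at most `d·L` steps per word (lit `length_treeWord`, `l1_boxVec_le`), weights `L⁻ᵈ` summing to one.  (The trunk weight is `≤ 1`, the crude `d·L` is L-only and enough.)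
[cite: Balaban1985Averaging, (14) p.19, (42) p.23] -/
theorem norm_cornerPiece_le_box (L : ℕ) (hL : 1 ≤ L) (S : ℕ → Site d → Fin d → 𝔸) (D : ℕ → Site d → 𝔸)
    (hD : ∀ (m : ℕ) (y : Site d), D m y = ∑ r : Fin d → Fin L, (((L : ℝ) ^ d)⁻¹) • asum (S m) y (treeWord (boxVec L r)))
    (m : ℕ) (y : Site d) (Bx : Finset (Site d))
    (hBx : ∀ (r : Fin d → Fin L),
      ∀ s ∈ List.zip (List.scanl (fun (z : Site d) (l' : Letter d) => z + l'.vec) y (treeWord (boxVec L r))) (treeWord (boxVec L r)), s.1 ∈ Bx) :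
    ‖D m y‖ ≤ d * L * ∑ x ∈ Bx, ∑ μ : Fin d, ‖S m x μ‖ := by
  classical
  set M : ℝ := ∑ x ∈ Bx, ∑ μ : Fin d, ‖S m x μ‖ with hM
  have hM0 : 0 ≤ M := Finset.sum_nonneg fun _ _ => Finset.sum_nonneg fun _ _ => norm_nonneg _
  have hc0 : 0 ≤ ((L : ℝ) ^ d)⁻¹ := by positivity
  rw [cornerPiece_eq_sum_steps L S D hD m y]
  -- each word: `‖L⁻ᵈ • Σ_steps S‖ ≤ L⁻ᵈ · |word| · M`
  have hword : ∀ r : Fin d → Fin L,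
      ‖(((L : ℝ) ^ d)⁻¹) • ((List.zip (List.scanl (fun (z : Site d) (l' : Letter d) => z + l'.vec) y (treeWord (boxVec L r)))
          (treeWord (boxVec L r))).map fun s => S m s.1 s.2.1).sum‖
        ≤ ((L : ℝ) ^ d)⁻¹ * (((treeWord (boxVec L r)).length : ℝ) * M) := by
    intro r
    set steps := List.zip (List.scanl (fun (z : Site d) (l' : Letter d) => z + l'.vec) y (treeWord (boxVec L r))) (treeWord (boxVec L r))
      with hsteps
    refine (norm_smul_le _ _).trans ?_
    rw [Real.norm_of_nonneg hc0]
    refine mul_le_mul_of_nonneg_left ?_ hc0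
    -- the list of norms, each `≤ M`
    have hlen : steps.length ≤ (treeWord (boxVec L r)).length := by
      rw [hsteps, List.length_zip]; exact min_le_right _ _
    have hterm : ∀ s ∈ steps, ‖S m s.1 s.2.1‖ ≤ M := by
      intro s hs
      have hx : s.1 ∈ Bx := hBx r s hs
      calc ‖S m s.1 s.2.1‖ ≤ ∑ μ : Fin d, ‖S m s.1 μ‖ :=
            Finset.single_le_sum (f := fun μ => ‖S m s.1 μ‖) (fun _ _ => norm_nonneg _) (Finset.mem_univ _)
        _ ≤ M := Finset.single_le_sum (f := fun x => ∑ μ : Fin d, ‖S m x μ‖) (fun _ _ => Finset.sum_nonneg fun _ _ => norm_nonneg _) hx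
    calc ‖(steps.map fun s => S m s.1 s.2.1).sum‖ ≤ (steps.map fun s => ‖S m s.1 s.2.1‖).sum := norm_list_map_sum_le _ steps
      _ ≤ (steps.map fun _ => M).sum := by
          refine List.sum_le_sum fun s hs => hterm s hs
      _ = (steps.length : ℝ) * M := by rw [List.map_const', List.sum_replicate, nsmul_eq_mul]
      _ ≤ ((treeWord (boxVec L r)).length : ℝ) * M := mul_le_mul_of_nonneg_right (by exact_mod_cast hlen) hM0
  calc ‖∑ r : Fin d → Fin L, (((L : ℝ) ^ d)⁻¹) • ((List.zip (List.scanl (fun (z : Site d) (l' : Letter d) => z + l'.vec) y (treeWord (boxVec L r)))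
          (treeWord (boxVec L r))).map fun s => S m s.1 s.2.1).sum‖
      ≤ ∑ r : Fin d → Fin L, ((L : ℝ) ^ d)⁻¹ * (((treeWord (boxVec L r)).length : ℝ) * M) := (norm_sum_le _ _).trans (Finset.sum_le_sum fun r _ => hword r)
    _ = (∑ r : Fin d → Fin L, ((L : ℝ) ^ d)⁻¹ * ((treeWord (boxVec L r)).length : ℝ)) * M := by
        rw [Finset.sum_mul]; refine Finset.sum_congr rfl fun r _ => by ring
    _ ≤ (d * L) * M := mul_le_mul_of_nonneg_right (sum_weight_length_treeWord_le L hL) hM0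
    _ = d * L * ∑ x ∈ Bx, ∑ μ : Fin d, ‖S m x μ‖ := by rw [hM]

/-- The CORNER BOX qualifies: every step site of `treeWord (boxVec L r)` from `y` is `y + boxVec L r′` for some `r′ ∈ [0,L)ᵈ` (✓II-2b `mem_steps_treeWord_inBox`).
[cite: Balaban1985Averaging, (2) p.17, (14) p.19] -/
theorem steps_mem_cornerBox (L : ℕ) (r : Fin d → Fin L) (y : Site d)
    {s : Site d × Letter d}
    (hs : s ∈ List.zip (List.scanl (fun (z : Site d) (l' : Letter d) => z + l'.vec) y (treeWord (boxVec L r))) (treeWord (boxVec L r))) :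
    s.1 ∈ (Finset.univ : Finset (Fin d → Fin L)).image fun r' => y + boxVec L r' := by
  classical
  have hin := mem_steps_treeWord_inBox L r y hs
  rw [Finset.mem_image]
  refine ⟨fun i => ⟨(s.1 i - y i).toNat, ?_⟩, Finset.mem_univ _, ?_⟩
  · have h1 := (hin i).1; have h2 := (hin i).2
    have : (s.1 i - y i).toNat < L := by
      have hnn : 0 ≤ s.1 i - y i := by linarith
      have : ((s.1 i - y i).toNat : ℤ) < L := by rw [Int.toNat_of_nonneg hnn]; linarith
      exact_mod_cast this
    exact this
  · funext i
    have h1 := (hin i).1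
    simp only [Pi.add_apply, boxVec]
    rw [Int.toNat_of_nonneg (by linarith)]
    ring

/-- ★★ **THE CORNER PIECE READS THE SOURCE ONLY BELOW THE CORNER**: along a LOCALISED absorbing chain `U` (`U m ⊇` the step sites of the tree words from `y`; `L•z + r + t•e_κ ∈ U i`
for `z ∈ U (i+1)`, `i < m`, every `κ`), `‖D m y‖ ≤ d·L·(L·L⁻ᵈ)ᵐ·Σ_{x∈U 0}Σ_μ‖S 0 x μ‖` — §2 ∘ §1.  (The consumer takes `U i :=` the cornered box of side `< 2L^{m+1−i}` below `y`.)
[cite: Balaban1985Averaging, (42)–(43) pp.23–24, (125) p.36] -/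
theorem norm_cornerPiece_le_localised (L : ℕ) (hL : 1 ≤ L) (S : ℕ → Site d → Fin d → 𝔸) (D : ℕ → Site d → 𝔸)
    (hS : ∀ (m : ℕ) (z : Site d) (κ : Fin d),
      S (m + 1) z κ = ∑ r : Fin d → Fin L, (((L : ℝ) ^ d)⁻¹) • asum (S m) ((L : ℤ) • z + boxVec L r) (seg κ (L : ℤ)))
    (hD : ∀ (m : ℕ) (y : Site d), D m y = ∑ r : Fin d → Fin L, (((L : ℝ) ^ d)⁻¹) • asum (S m) y (treeWord (boxVec L r)))
    (m : ℕ) (y : Site d) (U : ℕ → Finset (Site d))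
    (hUtop : ∀ (r : Fin d → Fin L),
      ∀ s ∈ List.zip (List.scanl (fun (z : Site d) (l' : Letter d) => z + l'.vec) y (treeWord (boxVec L r))) (treeWord (boxVec L r)), s.1 ∈ U m)
    (hU : ∀ i, i < m → ∀ (κ : Fin d), ∀ z ∈ U (i + 1), ∀ (r : Fin d → Fin L) (t : ℕ), t < L → (L : ℤ) • z + boxVec L r + (t : ℤ) • e κ ∈ U i) :
    ‖D m y‖ ≤ d * L * (((L : ℝ) * ((L : ℝ) ^ d)⁻¹) ^ m * ∑ x ∈ U 0, ∑ μ : Fin d, ‖S 0 x μ‖) := by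
  have h1 := norm_cornerPiece_le_box L hL S D hD m y (U m) hUtop
  have h2 : ∑ x ∈ U m, ∑ μ : Fin d, ‖S m x μ‖ ≤ ((L : ℝ) * ((L : ℝ) ^ d)⁻¹) ^ m * ∑ x ∈ U 0, ∑ μ : Fin d, ‖S 0 x μ‖ := by
    rw [Finset.sum_comm, Finset.sum_comm (s := U 0), Finset.mul_sum]
    refine Finset.sum_le_sum fun μ _ => ?_
    exact straight_tower_sum_norm_le L hL S μ (fun i z => hS i z μ) m U (fun i hi z hz r t ht => hU i hi μ z hz r t ht)
  have hdL : (0 : ℝ) ≤ d * L := by positivity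
  exact h1.trans (mul_le_mul_of_nonneg_left h2 hdL)

/-! ## §3 The `ℓ¹` knit of the structure theorem -/

/-- ★★ **`ℓ¹` OF THE CORNERED COMB AVERAGE, STRUCTURE FORM**: over any finite set `Zk` of level-`k` sites,
`Σ_{z∈Zk}Σ_κ‖B k z κ‖ ≤ Σ_{z∈Zk}Σ_κ‖S k z κ‖ + Σ_{m<k}Σ_{z∈Zk}Σ_κ(‖D m (L^{k−m}•z)‖ + ‖D m (L^{k−m}•(z + e κ))‖)` (✓II-1 `cornerComb_flat_structure` + triangle inequality).
[cite: Balaban1985Averaging, (42)–(43) pp.23–24] -/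
theorem sum_norm_cornerComb_le (L : ℕ) (hL : 1 ≤ L) (B S : ℕ → Site d → Fin d → 𝔸) (D : ℕ → Site d → 𝔸)
    (hB : ∀ (m : ℕ) (z : Site d) (κ : Fin d),
      B (m + 1) z κ = ∑ r : Fin d → Fin L, (((L : ℝ) ^ d)⁻¹) • asum (B m) ((L : ℤ) • z) (gammaWord L κ (boxVec L r)))
    (hS0 : ∀ (z : Site d) (κ : Fin d), S 0 z κ = B 0 z κ)
    (hS : ∀ (m : ℕ) (z : Site d) (κ : Fin d),
      S (m + 1) z κ = ∑ r : Fin d → Fin L, (((L : ℝ) ^ d)⁻¹) • asum (S m) ((L : ℤ) • z + boxVec L r) (seg κ (L : ℤ)))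
    (hD : ∀ (m : ℕ) (y : Site d), D m y = ∑ r : Fin d → Fin L, (((L : ℝ) ^ d)⁻¹) • asum (S m) y (treeWord (boxVec L r)))
    (k : ℕ) (Zk : Finset (Site d)) :
    ∑ z ∈ Zk, ∑ κ : Fin d, ‖B k z κ‖ ≤
      ∑ z ∈ Zk, ∑ κ : Fin d, ‖S k z κ‖ +
        ∑ m ∈ Finset.range k, ∑ z ∈ Zk, ∑ κ : Fin d,
          (‖D m (((L : ℤ) ^ (k - m)) • z)‖ + ‖D m (((L : ℤ) ^ (k - m)) • (z + e κ))‖) := by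
  have hpt : ∀ (z : Site d) (κ : Fin d), ‖B k z κ‖ ≤ ‖S k z κ‖ +
      ∑ m ∈ Finset.range k, (‖D m (((L : ℤ) ^ (k - m)) • z)‖ + ‖D m (((L : ℤ) ^ (k - m)) • (z + e κ))‖) := by
    intro z κ
    rw [cornerComb_flat_structure L hL B S D hB hS0 hS hD k z κ]
    refine (norm_add_le _ _).trans (add_le_add le_rfl ?_)
    exact (norm_sum_le _ _).trans (Finset.sum_le_sum fun m _ => norm_sub_le _ _)
  calc ∑ z ∈ Zk, ∑ κ : Fin d, ‖B k z κ‖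
      ≤ ∑ z ∈ Zk, ∑ κ : Fin d, (‖S k z κ‖ +
          ∑ m ∈ Finset.range k, (‖D m (((L : ℤ) ^ (k - m)) • z)‖ + ‖D m (((L : ℤ) ^ (k - m)) • (z + e κ))‖)) :=
        Finset.sum_le_sum fun z _ => Finset.sum_le_sum fun κ _ => hpt z κ
    _ = ∑ z ∈ Zk, ∑ κ : Fin d, ‖S k z κ‖ +
          ∑ z ∈ Zk, ∑ κ : Fin d, ∑ m ∈ Finset.range k, (‖D m (((L : ℤ) ^ (k - m)) • z)‖ + ‖D m (((L : ℤ) ^ (k - m)) • (z + e κ))‖) := by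
        rw [← Finset.sum_add_distrib]
        exact Finset.sum_congr rfl fun z _ => Finset.sum_add_distrib
    _ = _ := by
        congr 1
        calc ∑ z ∈ Zk, ∑ κ : Fin d, ∑ m ∈ Finset.range k, (‖D m (((L : ℤ) ^ (k - m)) • z)‖ + ‖D m (((L : ℤ) ^ (k - m)) • (z + e κ))‖)
            = ∑ z ∈ Zk, ∑ m ∈ Finset.range k, ∑ κ : Fin d, (‖D m (((L : ℤ) ^ (k - m)) • z)‖ + ‖D m (((L : ℤ) ^ (k - m)) • (z + e κ))‖) :=
              Finset.sum_congr rfl fun z _ => Finset.sum_comm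
          _ = ∑ m ∈ Finset.range k, ∑ z ∈ Zk, ∑ κ : Fin d, (‖D m (((L : ℤ) ^ (k - m)) • z)‖ + ‖D m (((L : ℤ) ^ (k - m)) • (z + e κ))‖) :=
              Finset.sum_comm

/-- ★★★ **THE `ℓ¹` OF THE `k`-FOLD CORNERED COMB AVERAGE WITH CORNER-LOCALISED READING OF THE SOURCE** (flat, abelian; any `d`, `L ≥ 1`).  Let `B, S, D` be ✓II-1's families of the
source `X := B 0` (`hB hS0 hS hD` VERBATIM), `Zk` a finite set of level-`k` sites, `Z` an absorbing chain with `Z k = Zk` (straight part), and for every `m < k` and every level-`k`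
corner `w` a LOCALISED absorbing chain `U m w` (`U m w m ⊇` the step sites of the tree words from `w`; absorbing below).  Then
`Σ_{z∈Zk}Σ_κ‖B k z κ‖ ≤ (L·L⁻ᵈ)ᵏ·Σ_{y∈Z 0}Σ_κ‖X y κ‖ + d·L·Σ_{m<k}(L·L⁻ᵈ)ᵐ·Σ_{z∈Zk}Σ_κ(Σ_{x∈U m (L^{k−m}•z) 0}Σ_μ‖X x μ‖ + Σ_{x∈U m (L^{k−m}•(z+e κ)) 0}Σ_μ‖X x μ‖)`
— the straight sector contracts (`d = 3`: `L^{−2k}`), the Λ-sector does not, but reads `X` only on the boxes `U · 0` BELOW THE LEVEL-`k` CORNERS (MASTER §4's «samples»); the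
localised-mass row ✓p705643∕✓p706697 then prices those boxes by volume fraction + gradient.  «(O2) groundwork.» [cite: Balaban1985Averaging, (42)–(43) pp.23–24, (125) p.36] -/
theorem sum_norm_cornerComb_le_localised (L : ℕ) (hL : 1 ≤ L) (B S : ℕ → Site d → Fin d → 𝔸) (D : ℕ → Site d → 𝔸)
    (hB : ∀ (m : ℕ) (z : Site d) (κ : Fin d),
      B (m + 1) z κ = ∑ r : Fin d → Fin L, (((L : ℝ) ^ d)⁻¹) • asum (B m) ((L : ℤ) • z) (gammaWord L κ (boxVec L r)))
    (hS0 : ∀ (z : Site d) (κ : Fin d), S 0 z κ = B 0 z κ)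
    (hS : ∀ (m : ℕ) (z : Site d) (κ : Fin d),
      S (m + 1) z κ = ∑ r : Fin d → Fin L, (((L : ℝ) ^ d)⁻¹) • asum (S m) ((L : ℤ) • z + boxVec L r) (seg κ (L : ℤ)))
    (hD : ∀ (m : ℕ) (y : Site d), D m y = ∑ r : Fin d → Fin L, (((L : ℝ) ^ d)⁻¹) • asum (S m) y (treeWord (boxVec L r)))
    (k : ℕ) (Zk : Finset (Site d))
    (Z : ℕ → Finset (Site d)) (hZk : Z k = Zk)
    (hZ : ∀ m, m < k → ∀ (κ : Fin d), ∀ z ∈ Z (m + 1), ∀ (r : Fin d → Fin L) (t : ℕ), t < L → (L : ℤ) • z + boxVec L r + (t : ℤ) • e κ ∈ Z m)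
    (U : ℕ → Site d → ℕ → Finset (Site d))
    (hUtop : ∀ m, m < k → ∀ (w : Site d) (r : Fin d → Fin L),
      ∀ s ∈ List.zip (List.scanl (fun (z : Site d) (l' : Letter d) => z + l'.vec) w (treeWord (boxVec L r))) (treeWord (boxVec L r)), s.1 ∈ U m w m)
    (hU : ∀ m, m < k → ∀ (w : Site d), ∀ i, i < m → ∀ (κ : Fin d), ∀ z ∈ U m w (i + 1), ∀ (r : Fin d → Fin L) (t : ℕ), t < L →
      (L : ℤ) • z + boxVec L r + (t : ℤ) • e κ ∈ U m w i) :
    ∑ z ∈ Zk, ∑ κ : Fin d, ‖B k z κ‖ ≤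
      ((L : ℝ) * ((L : ℝ) ^ d)⁻¹) ^ k * ∑ y ∈ Z 0, ∑ κ : Fin d, ‖B 0 y κ‖ +
        d * L * ∑ m ∈ Finset.range k, ((L : ℝ) * ((L : ℝ) ^ d)⁻¹) ^ m *
          ∑ z ∈ Zk, ∑ κ : Fin d,
            (∑ x ∈ U m (((L : ℤ) ^ (k - m)) • z) 0, ∑ μ : Fin d, ‖B 0 x μ‖ +
              ∑ x ∈ U m (((L : ℤ) ^ (k - m)) • (z + e κ)) 0, ∑ μ : Fin d, ‖B 0 x μ‖) := by
  have h0 := sum_norm_cornerComb_le L hL B S D hB hS0 hS hD k Zk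
  have hS0' : ∀ (x : Site d), (∑ μ : Fin d, ‖S 0 x μ‖) = ∑ μ : Fin d, ‖B 0 x μ‖ := fun x => Finset.sum_congr rfl fun μ _ => by rw [hS0]
  -- straight part along `Z`
  have hstraight : ∑ z ∈ Zk, ∑ κ : Fin d, ‖S k z κ‖ ≤ ((L : ℝ) * ((L : ℝ) ^ d)⁻¹) ^ k * ∑ y ∈ Z 0, ∑ κ : Fin d, ‖B 0 y κ‖ := by
    rw [← hZk, Finset.sum_comm, Finset.sum_comm (s := Z 0), Finset.mul_sum]
    refine Finset.sum_le_sum fun κ _ => ?_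
    have h := straight_tower_sum_norm_le L hL S κ (fun i z => hS i z κ) k Z (fun i hi z hz r t ht => hZ i hi κ z hz r t ht)
    refine h.trans (le_of_eq ?_)
    congr 1
    exact Finset.sum_congr rfl fun y _ => by rw [hS0]
  -- every corner piece along its localised chain
  have hcorner : ∀ m, m < k → ∀ (w : Site d),
      ‖D m w‖ ≤ d * L * (((L : ℝ) * ((L : ℝ) ^ d)⁻¹) ^ m * ∑ x ∈ U m w 0, ∑ μ : Fin d, ‖B 0 x μ‖) := by
    intro m hm w
    have h := norm_cornerPiece_le_localised L hL S D hS hD m w (U m w) (hUtop m hm w) (hU m hm w)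
    rw [Finset.sum_congr rfl fun x _ => hS0' x] at h
    exact h
  have hΛ : ∑ m ∈ Finset.range k, ∑ z ∈ Zk, ∑ κ : Fin d,
        (‖D m (((L : ℤ) ^ (k - m)) • z)‖ + ‖D m (((L : ℤ) ^ (k - m)) • (z + e κ))‖)
      ≤ d * L * ∑ m ∈ Finset.range k, ((L : ℝ) * ((L : ℝ) ^ d)⁻¹) ^ m *
          ∑ z ∈ Zk, ∑ κ : Fin d,
            (∑ x ∈ U m (((L : ℤ) ^ (k - m)) • z) 0, ∑ μ : Fin d, ‖B 0 x μ‖ +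
              ∑ x ∈ U m (((L : ℤ) ^ (k - m)) • (z + e κ)) 0, ∑ μ : Fin d, ‖B 0 x μ‖) := by
    rw [Finset.mul_sum]
    refine Finset.sum_le_sum fun m hm => ?_
    have hm' : m < k := Finset.mem_range.mp hm
    rw [Finset.mul_sum, Finset.mul_sum]
    refine Finset.sum_le_sum fun z _ => ?_
    rw [Finset.mul_sum, Finset.mul_sum]
    refine Finset.sum_le_sum fun κ _ => ?_
    have h1 := hcorner m hm' (((L : ℤ) ^ (k - m)) • z)
    have h2 := hcorner m hm' (((L : ℤ) ^ (k - m)) • (z + e κ))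
    calc ‖D m (((L : ℤ) ^ (k - m)) • z)‖ + ‖D m (((L : ℤ) ^ (k - m)) • (z + e κ))‖
        ≤ d * L * (((L : ℝ) * ((L : ℝ) ^ d)⁻¹) ^ m * ∑ x ∈ U m (((L : ℤ) ^ (k - m)) • z) 0, ∑ μ : Fin d, ‖B 0 x μ‖) +
          d * L * (((L : ℝ) * ((L : ℝ) ^ d)⁻¹) ^ m * ∑ x ∈ U m (((L : ℤ) ^ (k - m)) • (z + e κ)) 0, ∑ μ : Fin d, ‖B 0 x μ‖) := add_le_add h1 h2
      _ = _ := by ring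
  linarith [h0, hstraight, hΛ]

end Summit.QuantumFields.YangMills.Theorems.Prop7CornerCombFlatL1Localised
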